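import Summits.QuantumFields.YangMills.Theses.HistoryWedge
import Summits.QuantumFields.YangMills.Theorems.CutoffNotchTransportHistoryTailOfNotchRated
import Literature.MathematicalPhysics.QuantumFieldTheory.Balaban1983to89.T3AveragedTailProfile
import Literature.MathematicalPhysics.QuantumFieldTheory.Balaban1983to89.T3HistoryTailReduction
import HarnessLib

/-!
# Route `HistoryWedge`, support item `HistoryTailOfWedge` (stmt-QuantumFields-27960): the per-plaquette floor currency ON THE HISTORY
# WEDGE `K ≤ m·(K − j + 1)` gives K2's body `HistoryTailAt F γ b₀ p₀ m` — hence `WedgeTailL → UnitScaleTilt.HistoryTailL` BY NAME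

Seat `ym-line-sfw-p2-w2` g20 (width seat of cell `ym-idea-1`, free hands; critic idea-crit-5 verdict #105 price (2): «land the glue first
and general»).  Rung R3 of LADDER-YM is a RECORD rung: no summit, no continuum limit, no mass gap is proved by any of this; the cruxes
`WedgeTailL` (stmt-QuantumFields-27959) and the parent's residuals stay open.

WHAT.
* §1 ★ `historyTailAt_of_averagedTailOnWedge` — the bare height `j = 0` is the landed `T3BareTailProfile.bareTailAt`; a summable profile
  `q ≥ 0` (summable tail sums) bounding the block-AVERAGED single-height large-field masses `Gibbs_K{¬PlaqSmall θ(K−j) (Ū^{j})} ≤ q(K−j)`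
  ONLY for `1 ≤ j ≤ K` on the wedge `K ≤ m·(K − j + 1)` gives `HistoryTailAt F γ b₀ p₀ m` (the general reduction
  `T3HistoryTailReduction.historyTailAt_of_heightTailOnWedge'`, landed with this file, fed with the profile `q_bare + q`).
* §2 ★★ `historyTailAt_of_floorOnWedge` — the FLOOR currency of route `HistoryWedge`: `D ≥ 0`, `0 ≤ ρ`, `ρ·L³ < 1` with
  `Gibbs_K{θ(K−j) ≤ |Ū^{j}(∂p) − 1|} ≤ D·ρ^{K−j}` for every plaquette `p` of height `1 ≤ j ≤ K` ON THE WEDGE gives `HistoryTailAt F γ b₀ p₀ m`: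
  union bound over the `≤ 72·L^{3m_F}·(L^{K−j})³` plaquettes of the height (`CutoffNotchTransport.card_plaq_le_height`), so the height costs
  `72·L^{3m_F}·D·(ρL³)^{K−j}` — a geometric profile in the remaining height, summable with summable tail sums because `ρL³ < 1`.
* §3 ★★ `historyTailOfWedge_proof : Theses.HistoryWedge.HistoryTailOfWedge` (closes stmt-QuantumFields-27960) and the by-name corollary
  `historyTailL_of_wedgeTailL : WedgeTailL → UnitScaleTilt.HistoryTailL` (same profile `(b₀, p₀)`, same `γ₁(m)`; `p₀ > 2 ⇒ p₀ ≥ 1`,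
  `γ ≤ γ₁ ≤ 1`).

HONEST FRAMING.  Pure bookkeeping over the tree's definitions (union bounds, geometric series); no estimate of Bałaban's is asserted.

References: T. Bałaban, CMP **102** (1985) 255–275 [Balaban1985UV3] ((7) p.257: the decomposition of unity over heights; (71) p.273: the
per-plaquette large-field factors); C. King, CMP **102** (1986) 649–677 [King1986] ((3.12) p.657: the free top fraction `1/m`).
-/

set_option autoImplicit false

noncomputable section

open MeasureTheory
open scoped BigOperators

namespace Summit.QuantumFields.YangMills.Theorems.HistoryWedgeGlue

open Literature.MathematicalPhysics.QuantumFieldTheory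
open Literature.MathematicalPhysics.QuantumFieldTheory.Balaban1983to89
open Literature.MathematicalPhysics.QuantumFieldTheory.Balaban1983to89.T3ContinuumYM3Torus
open Literature.MathematicalPhysics.QuantumFieldTheory.Balaban1983to89.T3UnitScaleTilt
open Literature.MathematicalPhysics.QuantumFieldTheory.Balaban1983to89.T3UnitLawDensityEML (ℰp)
open Literature.MathematicalPhysics.QuantumFieldTheory.Balaban1983to89.T3CruxEstimates (real_not_plaqSmall_comp_le_sum)
open Literature.MathematicalPhysics.QuantumFieldTheory.Balaban1983to89.T3BareTailProfile (bareTailAt)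
open Literature.MathematicalPhysics.QuantumFieldTheory.Balaban1983to89.T3HistoryTailReduction (historyTailAt_of_heightTailOnWedge')
open Summit.QuantumFields.YangMills.Theorems.CutoffNotchTransport (card_plaq_le_height)

/-! ## §1 Averaged heights on the wedge suffice (the bare height is landed) -/

/-- Shifted tails of a summable profile are summable. [folklore] -/
private theorem summable_shift {q : ℕ → ℝ} (hq : Summable q) (n : ℕ) : Summable fun t => q (t + n) :=
  (summable_nat_add_iff n).mpr hq

/-- ★ **AVERAGED HEIGHTS ON THE WEDGE SUFFICE** (`0 < γ ≤ 1`, `0 < b₀`, `1 ≤ p₀`, `m ≥ 1`): a profile `q ≥ 0`, `Σ q < ∞`, `Σ_n Σ'_t q(t+n) < ∞`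
bounding `Gibbs_K{¬PlaqSmall θ(K−j) (Ū^{j})} ≤ q(K−j)` for the heights `1 ≤ j ≤ K` ON THE WEDGE `K ≤ m·(K − j + 1)` only, gives
`HistoryTailAt F γ b₀ p₀ m`.  The bare height `j = 0` is `T3BareTailProfile.bareTailAt`; the two profiles add; then
`historyTailAt_of_heightTailOnWedge'`. [cite: Balaban1985UV3, (7) p.257 and (71) p.273] -/
theorem historyTailAt_of_averagedTailOnWedge (F : T3Family) {γ b₀ p₀ : ℝ} (hγ : 0 < γ) (hγ1 : γ ≤ 1) (hb₀ : 0 < b₀)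
    (hp₀ : 1 ≤ p₀) {m : ℕ} (hm : 0 < m) (q : ℕ → ℝ) (hq0 : ∀ i, 0 ≤ q i) (hq : Summable q)
    (hqt : Summable fun n => ∑' t, q (t + n))
    (h : ∀ K j : ℕ, 1 ≤ j → j ≤ K → K ≤ m * (K - j + 1) →
      (gibbsK F ℰp γ K).real
          {U | ¬ PlaqSmall (θBal F.L γ b₀ p₀ (K - j))
            (Averaging.iter (fun i => BlockAveraging.blockAvg (P := F.P K) (j := i) ℰp) j U)} ≤ q (K - j)) :
    HistoryTailAt F γ b₀ p₀ m := by
  obtain ⟨q₁, hq₁0, hq₁, hq₁t, h₁⟩ := bareTailAt F hγ hγ1 hb₀ hp₀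
  refine historyTailAt_of_heightTailOnWedge' F hγ.le b₀ p₀ hm (fun i => q₁ i + q i)
    (fun i => add_nonneg (hq₁0 i) (hq0 i)) (hq₁.add hq) ?_ fun K j hjK hw => ?_
  · have heq : (fun n => ∑' t, (q₁ (t + n) + q (t + n))) = fun n => (∑' t, q₁ (t + n)) + ∑' t, q (t + n) := by
      funext n
      exact (summable_shift hq₁ n).tsum_add (summable_shift hq n)
    rw [heq]
    exact hq₁t.add hqt
  · rcases Nat.eq_zero_or_pos j with rfl | hjpos
    · have hK : (gibbsK F ℰp γ K).real
          {U | ¬ PlaqSmall (θBal F.L γ b₀ p₀ (K - 0))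
            (Averaging.iter (fun i => BlockAveraging.blockAvg (P := F.P K) (j := i) ℰp) 0 U)} ≤ q₁ (K - 0) := h₁ K
      exact hK.trans (le_add_of_nonneg_right (hq0 _))
    · exact (h K j hjpos hjK hw).trans (le_add_of_nonneg_left (hq₁0 _))

/-! ## §2 The floor currency on the wedge -/

/-- `(L^i)³·ρ^i = (ρ·L³)^i`. [folklore] -/
private theorem pow_cube_mul_pow (L ρ : ℝ) (i : ℕ) : (L ^ i) ^ 3 * ρ ^ i = (ρ * L ^ 3) ^ i := by
  rw [mul_pow, ← pow_mul, ← pow_mul, mul_comm i 3, mul_comm]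

/-- Tail sums of a geometric profile: `Σ'_t A r^{t+n} = (A (1−r)⁻¹) r^n` for `0 ≤ r < 1`. [folklore] -/
private theorem tsum_geometric_shift {A r : ℝ} (hr0 : 0 ≤ r) (hr1 : r < 1) (n : ℕ) :
    ∑' t, A * r ^ (t + n) = A * (1 - r)⁻¹ * r ^ n := by
  have h1 : (fun t => A * r ^ (t + n)) = fun t => (A * r ^ n) * r ^ t := by
    funext t; rw [pow_add]; ring
  rw [h1, tsum_mul_left, tsum_geometric_of_lt_one hr0 hr1]
  ring

/-- ★★ **THE FLOOR CURRENCY ON THE WEDGE GIVES K2's BODY** (`0 < γ ≤ 1`, `0 < b₀`, `1 ≤ p₀`, `m ≥ 1`): if `D ≥ 0`, `0 ≤ ρ`, `ρ·L³ < 1` and every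
block-averaged plaquette `p` of height `1 ≤ j ≤ K` ON THE WEDGE `K ≤ m·(K − j + 1)` of every approximation `K` has Gibbs tail
`Gibbs_K{θ(K−j) ≤ |Ū^{j}(∂p) − 1|} ≤ D·ρ^{K−j}`, then `HistoryTailAt F γ b₀ p₀ m`.  Union bound over the `≤ 72·L^{3m_F}(L^{K−j})³` plaquettes
of the height (`card_plaq_le_height`): per height `72·L^{3m_F}·D·(ρL³)^{K−j}`, a geometric — hence summable, with summable tail sums — profile
in the remaining height; then §1. [cite: Balaban1985UV3, (7) p.257 and (71) p.273; King1986, (3.12) p.657] -/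
theorem historyTailAt_of_floorOnWedge (F : T3Family) {γ b₀ p₀ : ℝ} (hγ : 0 < γ) (hγ1 : γ ≤ 1) (hb₀ : 0 < b₀) (hp₀ : 1 ≤ p₀)
    {m : ℕ} (hm : 0 < m) {D ρ : ℝ} (hD : 0 ≤ D) (hρ : 0 ≤ ρ) (hρL : ρ * (F.L : ℝ) ^ 3 < 1)
    (h : ∀ K j : ℕ, 1 ≤ j → j ≤ K → K ≤ m * (K - j + 1) → ∀ p : Plaq (F.P K) j,
      (gibbsK F ℰp γ K).real
          {U | θBal F.L γ b₀ p₀ (K - j) ≤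
            GaugeGroup.dist1 (GaugeField.plaqHol
              (Averaging.iter (fun i => BlockAveraging.blockAvg (P := F.P K) (j := i) ℰp) j U) p)} ≤ D * ρ ^ (K - j)) :
    HistoryTailAt F γ b₀ p₀ m := by
  have hL0 : (0 : ℝ) < F.L := by exact_mod_cast lt_trans zero_lt_one F.hL.2
  -- the ratio and the constant of the geometric profile
  set r : ℝ := ρ * (F.L : ℝ) ^ 3 with hr
  have hr0 : 0 ≤ r := by positivity
  set A : ℝ := 72 * (F.L : ℝ) ^ (3 * F.m) * D with hA
  have hA0 : 0 ≤ A := by positivity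
  refine historyTailAt_of_averagedTailOnWedge F hγ hγ1 hb₀ hp₀ hm (fun i => A * r ^ i) (fun i => by positivity)
    ((summable_geometric_of_lt_one hr0 hρL).mul_left A) ?_ fun K j hj1 hjK hw => ?_
  · -- summable tail sums
    have heq : (fun n => ∑' t, A * r ^ (t + n)) = fun n => (A * (1 - r)⁻¹) * r ^ n := by
      funext n; exact tsum_geometric_shift hr0 hρL n
    rw [heq]
    exact (summable_geometric_of_lt_one hr0 hρL).mul_left _
  · -- one height on the wedge: union bound over its plaquettes
    haveI := isProbabilityMeasure_gibbsK F ℰp hγ.le K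
    have hunion := real_not_plaqSmall_comp_le_sum (gibbsK F ℰp γ K)
      (fun U => Averaging.iter (fun i => BlockAveraging.blockAvg (P := F.P K) (j := i) ℰp) j U) (θBal F.L γ b₀ p₀ (K - j))
    refine hunion.trans ?_
    refine (Finset.sum_le_sum fun p _ => h K j hj1 hjK hw p).trans ?_
    rw [Finset.sum_const, Finset.card_univ, nsmul_eq_mul]
    have hterm : 0 ≤ D * ρ ^ (K - j) := by positivity
    refine (mul_le_mul_of_nonneg_right (card_plaq_le_height F hjK) hterm).trans (le_of_eq ?_)
    show 72 * (F.L : ℝ) ^ (3 * F.m) * ((F.L : ℝ) ^ (K - j)) ^ 3 * (D * ρ ^ (K - j)) = A * r ^ (K - j)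
    rw [hA, hr, ← pow_cube_mul_pow]
    ring

/-! ## §3 The support item `HistoryTailOfWedge` and `WedgeTailL → HistoryTailL` by name -/

/-- ★★ **`HistoryTailOfWedge` HOLDS** (support item stmt-QuantumFields-27960 of route `HistoryWedge`): `WedgeTailL` gives, for every `L` and
every requested floor `(b₁, p₁)`, its own profile `(b₀, p₀) ≥ (b₁, p₁)` and, for every window parameter `m ≥ 1`, its own `γ₁(m) ≤ 1`; for a
family `F` with `F.L = L` and `0 < γ ≤ γ₁(m)` the floor constants `(D, ρ)`, `ρ·L³ < 1`, feed `historyTailAt_of_floorOnWedge` (`p₀ > 2 ⇒ p₀ ≥ 1`,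
`γ ≤ γ₁ ≤ 1`).  No summit and no rung is proved: `WedgeTailL` is open. [cite: Balaban1985UV3, (7) p.257 and (71) p.273; King1986, (3.12) p.657] -/
theorem historyTailOfWedge_proof : Summit.QuantumFields.YangMills.Theses.HistoryWedge.HistoryTailOfWedge := by
  unfold Summit.QuantumFields.YangMills.Theses.HistoryWedge.HistoryTailOfWedge
  intro hW L b₁ p₁
  obtain ⟨b₀, p₀, hb₁, hp₁, hb₀, hp₀, hmain⟩ := hW L b₁ p₁
  refine ⟨b₀, p₀, hb₁, hp₁, hb₀, hp₀, fun m hm => ?_⟩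
  obtain ⟨γ₁, hγ₁, hγ₁1, hF⟩ := hmain m hm
  refine ⟨γ₁, hγ₁, fun F γ hFL hγ hγle => ?_⟩
  obtain ⟨D, ρ, hD, hρ, hρL, hwedge⟩ := hF F γ hFL hγ hγle
  have hρL' : ρ * (F.L : ℝ) ^ 3 < 1 := by rw [hFL]; exact hρL
  exact historyTailAt_of_floorOnWedge F hγ (hγle.trans hγ₁1) hb₀ (by linarith) hm hD hρ hρL'
    fun K j hj1 hjK hw p => hwedge K j hj1 hjK hw p

/-- ★★ **`WedgeTailL → UnitScaleTilt.HistoryTailL` BY NAME**: the conclusion of `HistoryTailOfWedge` is verbatim the body of the parent route's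
crux K2′ `HistoryTailL` (stmt-QuantumFields-19936), so the route crux `WedgeTailL` (stmt-QuantumFields-27959) implies it.  Conditional:
`WedgeTailL` is open; nothing about `HistoryTailL` itself is proved here. [cite: Balaban1985UV3, (71) p.273; King1986, Thm 3.4 p.656] -/
theorem historyTailL_of_wedgeTailL (hW : Summit.QuantumFields.YangMills.Theses.HistoryWedge.WedgeTailL) :
    Summit.QuantumFields.YangMills.Theses.UnitScaleTilt.HistoryTailL :=
  historyTailOfWedge_proof hW

end Summit.QuantumFields.YangMills.Theorems.HistoryWedgeGlue

end
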